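import Summits.ABC.IUTFork.Cor312ThetaSideAssemblyM
import Summits.ABC.IUTFork.Cor312ThetaFiniteMSharp
import Summits.ABC.IUTFork.Cor312PilotIdelesM
import Summits.ABC.IUTFork.LDHTensorHoffCompletions
import HarnessLib

/-!
# [IUTchIII] Corollary 3.12 — hΘ AT THE M-LEVEL SHARP SETTING OF THE DATUM'S OWN IDELES: `−|log(Θ)| ≤ ↑(genuine −|log(Θ)|)`
# modulo the one per-packet orbit-hull bound (unit P6-instC of `HOME/staging/w5/w5-d166/g4/G1-THETA-SHAPES.md`)

PROOF-ONLY record file (D-0012; 0 definitions) of the abc-iut cell (seat abc-iut-w5-d166, gen 4; branch C «abc ⇐ S», C-lead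
ruling C-R12 (e) «target #2′»). TAKES NO SIDE on [IUTchIII] Cor. 3.12.

At abc-iut-w5-d166's frames-route M-level sharp setting `settingMSharp` (p435453) — carriers the genuine completions `K_{v̲}`,
`v̲ ∈ V̲` ([IUTchI] Def. 3.1 (e)), sharp Dupuy–Hilado Θ-regions (Dupuy–Hilado §4.10) — with the Θ-ideles READ OFF the idele
data `r` of the initial Θ-data (abc-iut-w5-d033's `tThetaM`, p436273; the ideles of abc-iut-S2's genuine input
`volumeInputOf D r`, `InitialThetaDataVolume`), the three local inputs of the assembly `negLogTheta_le_genuine_of_local_bounds`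
(unit P6-final, p438195) are supplied as follows:
* (h∞) — abc-iut-s2-p9's `thetaLocal_settingMSharp_arc` (p437661, unit P5): the archimedean local Θ-volume is `0`;
* (hlow) — abc-iut-s2-p9's `thetaLocal_settingMSharp_eq_zero` (ibid., [IUTchIV] Thm. 1.10 Step (vi)) at a finite place `u` whose
  prime `p_u` lies outside the support `T(I)` of the genuine input: `p_u > 2` and `p_u ∤ disc(K)` (`T(I) ⊇ (2·|disc K|).primeFactors`,
  abc-iut-c312-3 `two_lt_of_not_mem_primeFactors_two_mul_discr`) and the Θ-ideles over `u` are units (`T(I) ⊇ char(S)`;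
  abc-iut-w5-d033 `norm_tThetaM_eq_one_of_not_mem`) ⇒ the local Θ-volume IS `0`;
* (hA) — the per-packet ORBIT-HULL BOUND `thetaLocal (i+1) (Val.non u) ≤ ↑(orbitSumM D r i u)` (SHAPES (U1); [IUTchIV] Thm. 1.10
  Step (v); abc-iut-s2-p7's `Cor312ThetaLocalLeContentHull` p437184 is its content-hull form), kept as the ONE HYPOTHESIS of
  **`negLogTheta_settingMSharp_le_genuine_of_orbitHull`**: under it,
  `(settingMSharp … (t := tThetaM r) …).negLogTheta ≤ ↑(volumeInputOf D r).negLogTheta` — the READ binder `hΘ` of the branch-C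
  certificates AT THE M-LEVEL SETTING OF THE DATUM'S OWN IDELES (abc-iut-s2-p6 10:28:51Z: «READ 1 is a genuine count only if `t`
  is pinned … take `t :=` the input's own `I.tΘ` at the M-level setting»); the summand-route twin follows by abc-iut-s2-p8's
  `negLogTheta_settingMSharp_eq_settingPrVolSharpM` (p438078).
[cite: Mochizuki2012, IUTchIII Cor. 3.12 p. 173–174] [cite: Mochizuki2012, IUTchIV Thm. 1.10 Steps (v)–(viii) p. 27–30]
[cite: Mochizuki2012, IUTchI Def. 3.1 (e) p. 62] [cite: DupuyHilado2025, §4.10–4.12] [claim: Mochizuki2012, status: disputed]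
for the quoted notions. HONEST FRAMING: a comparison between OUR two typings of one printed quantity at the genuine carriers,
conditional on the named per-packet bound; nothing here bears on the truth of [IUTchIII] Cor. 3.12; typed ≠ proved;
instantiated ≠ endorsed.
-/

noncomputable section

open Set Function NumberField IsDedekindDomain
open scoped Pointwise Classical

namespace Summit.ABC.IUTFork.Thm311.Real

open Cor312 Cor312Vol Literature.IUT.LogThetaLattice Literature.IUT.LogVolume Literature.IUT.HodgeTheaters
  Literature.NumberTheory.NumberFields

variable {F K Fbar : Type} [Field F] [NumberField F] [Field K] [NumberField K] [Algebra F K]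
  [Field Fbar] [Algebra F Fbar] [Algebra K Fbar] {E : WeierstrassCurve F} [E.IsElliptic] {l : ℕ}
  {Pb : BadPlacePredicates K} (D : InitialThetaData F K Fbar E l Pb) {logvK : PadicLogsVal K}
  (hlog : LogvAnalyticVal logvK) (r : ThetaData.IdeleData D)

/-! ## §1. The Θ-ideles of the datum at the M-level presentation, as the setting's binder -/

/-- **The Θ-idele binder of `settingMSharp` READ OFF the idele data `r`**: `t u i x := tThetaM D p_u u _ r i x` (abc-iut-w5-d033's
read-off at the prime `p_u` of `u`). An abbreviation (no new object). [cite: DupuyHilado2025, §3.9] -/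
abbrev tOfIdeleData (u : FinitePlace ℚ) (i : Fin (thetaIndexOfInitial D).lstar)
    (x : (thetaIndexOfInitial D).Fibre (Val.non u)) : kOfM D (ratChar u) u (natCast_ratChar_mem u) x :=
  tThetaM D (ratChar u) u (natCast_ratChar_mem u) r i x

/-- `ht0` for the read-off ideles (units are non-zero; abc-iut-w5-d033 `tThetaM_ne_zero`). [folklore] -/
theorem tOfIdeleData_ne_zero (u : FinitePlace ℚ) (i : Fin (thetaIndexOfInitial D).lstar)
    (x : (thetaIndexOfInitial D).Fibre (Val.non u)) : tOfIdeleData D r u i x ≠ 0 :=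
  tThetaM_ne_zero D (ratChar u) u (natCast_ratChar_mem u) r i x

/-- **Off the support the read-off Θ-ideles are units**: if the prime `p_u` of `u` is NOT among the residue characteristics
of the bad places `S = V^bad_mod` of the pilot data of `D`, every `t_{Θ,i+1,v̲}`, `v̲ ∈ V̲_u`, has norm `1` (`P_Θ` is supported
on `S`; abc-iut-w5-d033 `norm_tThetaM_eq_one_of_not_mem`). [cite: DupuyHilado2025, §3.3, §3.9] -/
theorem norm_tOfIdeleData_eq_one_of_not_mem (u : FinitePlace ℚ)
    (hu : ratChar u ∉ (ThetaData.pilotData D).S.image (residueChar (fieldOfModuli E)))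
    (i : Fin (thetaIndexOfInitial D).lstar) (x : (thetaIndexOfInitial D).Fibre (Val.non u)) :
    ‖tOfIdeleData D r u i x‖ = 1 := by
  refine norm_tThetaM_eq_one_of_not_mem D (ratChar u) u (natCast_ratChar_mem u) r i x fun hx => hu ?_
  refine Finset.mem_image.mpr ⟨placeModOfM D u x, hx, ?_⟩
  exact residueChar_eq_of_natCast_mem (ratChar u)
    (natCast_mem_of_mem_placesOver (E := E) (ratChar u)
      ⟨placeModOfM D u x, placeModOfM_mem_placesOver D (ratChar u) u (natCast_ratChar_mem u) x⟩)

/-! ## §2. hΘ at the M-level sharp setting of the datum's own ideles, modulo the orbit-hull bound -/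

section Setting

variable (M : Type) [Field M] [NumberField M]
  (archPk : ∀ (j : (thetaIndexOfInitial D).Label) (vQ : (thetaIndexOfInitial D).VQ),
    Set ((logShellsOfInitialDH D logvK).Packet j vQ))
  (archSub : ∀ (j : (thetaIndexOfInitial D).Label) (v : (thetaIndexOfInitial D).V),
    Set ((logShellsOfInitialDH D logvK).Packet j ((thetaIndexOfInitial D).over v)))
  (Ψ : ℤ → ∀ v : (thetaIndexOfInitial D).V, v ∈ (thetaIndexOfInitial D).Vbad →
    Set ((logShellsOfInitialDH D logvK).StarPacket v))
  (act : ℤ → ∀ v : (thetaIndexOfInitial D).V, v ∈ (thetaIndexOfInitial D).Vbad →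
    (logShellsOfInitialDH D logvK).StarPacket v → Module.End ℚ ((logShellsOfInitialDH D logvK).StarPacket v))
  (Mmod : ℤ → ∀ j : (thetaIndexOfInitial D).LabelStar, Set ((logShellsOfInitialDH D logvK).GlobalPacket j.1))
  (region : ℤ → ∀ j : (thetaIndexOfInitial D).LabelStar, FinDivisor M → ∀ vQ : (thetaIndexOfInitial D).VQ,
    Set ((logShellsOfInitialDH D logvK).Packet j.1 vQ))
  (n : ℤ) {HT : Type} {LogLink : HT → HT → Type} {IsFull : ∀ {s t : HT}, LogLink s t → Prop}
  (lat : LGPGaussianLogThetaLattice LogLink IsFull)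
  {Frd : Type} {IsoF : Frd → Frd → Type} {Ob : Frd → Type} {realify : Frd → Frd} {Strip : Type}
  {IsoS : Strip → Strip → Type} {Mv : ∀ v : (thetaIndexOfInitial D).V, v ∈ (thetaIndexOfInitial D).Vbad → Type}
  [∀ v h, Monoid (Mv v h)]
  (sig : GlobalLGPFrobenioidSignature (thetaIndexOfInitial D).lstar (thetaIndexOfInitial D).V
    (· ∈ (thetaIndexOfInitial D).Vbad) Frd IsoF Ob realify Strip IsoS Mv)
  (split : SplittingMonoids Mv) {ObΔ : Type} {N : ∀ v : (thetaIndexOfInitial D).V, v ∈ (thetaIndexOfInitial D).Vbad → Type}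
  [∀ v h, Monoid (N v h)] (qData : QPilotData ObΔ N)
  (tq : ∀ (u : FinitePlace ℚ) (x : (thetaIndexOfInitial D).Fibre (Val.non u)),
    kOfM D (ratChar u) u (natCast_ratChar_mem u) x)
  (htq0 : ∀ u x, tq u x ≠ 0) (Sq : Finset (FinitePlace ℚ))
  (htq1 : ∀ (u : FinitePlace ℚ) (x : (thetaIndexOfInitial D).Fibre (Val.non u)), u ∉ Sq → ‖tq u x‖ = 1)

/-- **(hlow) DISCHARGED — Step (vi) at the datum's own ideles**: at a finite place `u` whose prime lies outside the support
`T(I)` of the genuine input `volumeInputOf D r`, the local Θ-volume of `settingMSharp` with the read-off Θ-ideles is `0`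
(abc-iut-s2-p9 `thetaLocal_settingMSharp_eq_zero` with `p_u > 2`, `p_u ∤ disc K`, unit ideles — all three from `p_u ∉ T(I)`).
[cite: Mochizuki2012, IUTchIV Thm. 1.10 Step (vi) p. 29] -/
theorem thetaLocal_settingMSharp_tOfIdeleData_eq_zero (i : Fin (thetaIndexOfInitial D).lstar) (u : FinitePlace ℚ)
    (hu : ratChar u ∉ (ThetaData.volumeInputOf D r).supportPrimes) :
    (settingMSharp D hlog M archPk archSub Ψ act Mmod region n lat sig split qData (tOfIdeleData D r) tq htq0 Sq htq1).thetaLocal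
        (Setting.labelSucc i) (Val.non u) = ((0 : ℝ) : WithTop ℝ) := by
  have hpf : ratChar u ∉ (2 * (NumberField.discr K).natAbs).primeFactors := fun h =>
    hu (DHData.primeFactors_subset_supportPrimes (ThetaData.volumeInputOf D r) h)
  have hp2 : 2 < ratChar u := two_lt_of_not_mem_primeFactors_two_mul_discr (K := K) (fact_ratChar_prime u).out hpf
  have hdisc : ¬ ((ratChar u : ℕ) : ℤ) ∣ NumberField.discr K := by
    intro hdvd
    apply hpf
    refine Nat.mem_primeFactors.mpr ⟨(fact_ratChar_prime u).out, ?_,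
      mul_ne_zero two_ne_zero (Int.natAbs_ne_zero.mpr (NumberField.discr_ne_zero K))⟩
    exact Dvd.dvd.mul_left (Int.natCast_dvd.mp (by simpa using hdvd)) 2
  have hS : ratChar u ∉ (ThetaData.pilotData D).S.image (residueChar (fieldOfModuli E)) := fun h =>
    hu (Finset.mem_union_right _ h)
  exact thetaLocal_settingMSharp_eq_zero D hlog M archPk archSub Ψ act Mmod region n lat sig split qData (tOfIdeleData D r)
    tq htq0 Sq htq1 (tOfIdeleData_ne_zero D r) i u hp2 hdisc (norm_tOfIdeleData_eq_one_of_not_mem D r u hS i)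

/-- **hΘ AT THE M-LEVEL SHARP SETTING OF THE DATUM'S OWN IDELES, modulo the orbit-hull bound.** For the initial Θ-data `D`,
idele data `r` and the frames-route M-level sharp setting with Θ-ideles `t := tThetaM r` (any `q`-ideles, context data and
column): IF at every finite place and label the local Θ-volume is bounded by the orbit sum (hA; SHAPES (U1), abc-iut-s2-p7's
content-hull bound in orbit form), THEN `−|log(Θ)| ≤ ↑(volumeInputOf D r).negLogTheta` — abc-iut-S2's genuine number of the
datum's own input. (h∞) and (hlow) are abc-iut-s2-p9's theorems; the assembly is unit P6-final.
[cite: Mochizuki2012, IUTchIII Cor. 3.12 p. 173–174] -/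
theorem negLogTheta_settingMSharp_le_genuine_of_orbitHull
    (hA : ∀ (i : Fin (thetaIndexOfInitial D).lstar) (u : FinitePlace ℚ),
      (settingMSharp D hlog M archPk archSub Ψ act Mmod region n lat sig split qData (tOfIdeleData D r) tq htq0 Sq
          htq1).thetaLocal (Setting.labelSucc i) (Val.non u) ≤ ((orbitSumM D r i u : ℝ) : WithTop ℝ)) :
    (settingMSharp D hlog M archPk archSub Ψ act Mmod region n lat sig split qData (tOfIdeleData D r) tq htq0 Sq htq1).negLogTheta ≤
      (((ThetaData.volumeInputOf D r).negLogTheta : ℝ) : WithTop ℝ) :=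
  negLogTheta_le_genuine_of_local_bounds D r _
    (fun i w => thetaLocal_settingMSharp_arc D hlog M archPk archSub Ψ act Mmod region n lat sig split qData (tOfIdeleData D r)
      tq htq0 Sq htq1 (Setting.labelSucc i) w)
    hA
    (fun i u hu => (thetaLocal_settingMSharp_tOfIdeleData_eq_zero D hlog r M archPk archSub Ψ act Mmod region n lat sig split
      qData tq htq0 Sq htq1 i u hu).symm.le)

/-- The same at abc-iut-s2-p8's SUMMAND-ROUTE sharp setting `settingPrVolSharpM` (p438078), by its route identity
`negLogTheta_settingMSharp_eq_settingPrVolSharpM`. [cite: Mochizuki2012, IUTchIII Cor. 3.12 p. 173–174] -/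
theorem negLogTheta_settingPrVolSharpM_le_genuine_of_orbitHull
    (hA : ∀ (i : Fin (thetaIndexOfInitial D).lstar) (u : FinitePlace ℚ),
      (settingMSharp D hlog M archPk archSub Ψ act Mmod region n lat sig split qData (tOfIdeleData D r) tq htq0 Sq
          htq1).thetaLocal (Setting.labelSucc i) (Val.non u) ≤ ((orbitSumM D r i u : ℝ) : WithTop ℝ)) :
    (settingPrVolSharpM D hlog (tOfIdeleData D r) tq M archPk archSub Ψ act Mmod region n lat sig split qData htq0 Sq
        htq1).negLogTheta ≤ (((ThetaData.volumeInputOf D r).negLogTheta : ℝ) : WithTop ℝ) := by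
  rw [← negLogTheta_settingMSharp_eq_settingPrVolSharpM]
  exact negLogTheta_settingMSharp_le_genuine_of_orbitHull D hlog r M archPk archSub Ψ act Mmod region n lat sig split qData
    tq htq0 Sq htq1 hA

end Setting

end Summit.ABC.IUTFork.Thm311.Real

end
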